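import Summits.ABC.IUTFork.Thm311Real2
import Summits.ABC.IUTFork.Thm311RealDH
import HarnessLib

/-!
# [IUTchIII] Theorem 3.11 over real definitions, D: (Ind1) and (Ind2) PRESERVE the nonarchimedean integral structures

Record-only file (D-0012) of the abc-iut cell (Cor. 3.12 sub-crew, wave-2 seat abc-iut-c312-5, board row
W2-A); TAKES NO SIDE on [IUTchIII] Cor. 3.12. `Thm311Real2` DEFINED, for any log-shell signature
`L : Thm311.LogShells T` (abc-iut-c312-1), the nonarchimedean integral structure
`L.shellPk j v_ℚ = I(^{S^±_{j+1}};D⊢_{v_ℚ})` of [IUTchIII] Prop. 3.2 (ii) — the additive subgroup of the tensor packet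
generated by the pure tensors of log-shell elements. Dupuy–Hilado (arXiv:2004.13228, read on the page) assert of
their explicit indeterminacies: §4.7 p. 14 "This map [the (Ind1) permutation] is `ℚ_p`-linear and fixes the lattice
`⊕ I_{(v_0,…,v_j)}`", and §4 p. 13 "We will also see that the Ind2 indeterminacies also preserve this lattice". This
file PROVES the corresponding statements for c312-1's (Ind1)/(Ind2) acting on the DEFINED integral structures,
for every `L`:

* `LogShells.permute_image_shellPk` — a permutation of the capsule `S^±_{j+1}` maps `I(^{S^±_{j+1}};D⊢_{v_ℚ})` onto
  itself;
* `LogShells.factorwise_summandwise_image_shellPk` — a family of summand-wise automorphisms `g_{i,v}` each mapping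
  the log-shell `I_v` onto itself maps `I(^{S^±_{j+1}};D⊢_{v_ℚ})` onto itself;
* hence `LogShells.image_shellPk_of_mem_Ind1` (under: every strip automorphism in `L.stripAut` preserves the
  shells) and `LogShells.image_shellPk_of_mem_Ind2` (under: every element of `L.ism` preserves the shells);
* for the Dupuy–Hilado-level instance `Real.logShellsDH` (abc-iut-c312-5, p406504: strip part trivial, Ism =
  lattice isomorphisms of `I_v`) both hypotheses hold at every PRIME `p` by definition, giving
  `Real.ind1_image_shellPk_DH` / `Real.ind2_image_shellPk_DH` unconditionally (no `LogvLaw` needed: this is set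
  preservation, not volume preservation — the latter is abc-iut-c312-d1's `LogShellVolumeInvariance`).

Everything is bookkeeping over landed definitions (`AddMonoidHom.map_closure`, c312-1's `permute_tprod` /
`factorwise_summandwise_tprod`). [cite: DupuyHilado2025, §4.7] [claim: Mochizuki2012, status: disputed]
typed ≠ discharged; instantiated ≠ endorsed.
-/

noncomputable section

namespace Summit.ABC.IUTFork.Thm311

open NumberField IsDedekindDomain Literature.IUT.LogVolume Literature.IUT.LogThetaLattice

variable {T : ThetaIndex}

namespace LogShells

variable (L : LogShells T)

/-- The generating set of `I(^{S^±_{j+1}};D⊢_{v_ℚ})`: pure tensors all of whose components lie in the (subgroups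
generated by the) log-shells. [claim: Mochizuki2012, status: disputed] -/
def shellTensors (j : T.Label) (vQ : T.VQ) : Set (L.Packet j vQ) :=
  {t | ∃ x : T.Caps j → L.Packet1 vQ, (∀ i (v : T.Fibre vQ), x i v ∈ L.shellSubgroup v.1) ∧ t = L.tprod j vQ x}

/-- `shellPk` is the subgroup generated by `shellTensors` (by definition). [folklore] -/
theorem shellPk_eq_closure (j : T.Label) (vQ : T.VQ) :
    L.shellPk j vQ = AddSubgroup.closure (L.shellTensors j vQ) := rfl

/-- A linear automorphism mapping the generating pure tensors ONTO themselves maps the integral structure onto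
itself. [folklore] -/
theorem image_shellPk_of_image_shellTensors {j : T.Label} {vQ : T.VQ} (f : L.Packet j vQ ≃ₗ[ℚ] L.Packet j vQ)
    (hf : f '' L.shellTensors j vQ = L.shellTensors j vQ) :
    f '' (L.shellPk j vQ : Set (L.Packet j vQ)) = L.shellPk j vQ := by
  set f' := f.toLinearMap.toAddMonoidHom
  have hff : (⇑f' : L.Packet j vQ → L.Packet j vQ) = ⇑f := rfl
  have h := AddMonoidHom.map_closure f' (L.shellTensors j vQ)
  have h2 : f' '' (AddSubgroup.closure (L.shellTensors j vQ) : Set (L.Packet j vQ)) =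
      (AddSubgroup.closure (f' '' L.shellTensors j vQ) : Set (L.Packet j vQ)) := by
    rw [← AddSubgroup.coe_map, h]
  rw [shellPk_eq_closure, ← hff, h2, hff, hf]

/-- **(Ind1), permutation part, FIXES THE LATTICE** (Dupuy–Hilado §4.7 p. 14: "This map is `ℚ_p`-linear and fixes
the lattice `⊕ I_{(v_0,…,v_j)}`"): permuting the tensor factors by `σ ∈ Perm(S^±_{j+1})` maps
`I(^{S^±_{j+1}};D⊢_{v_ℚ})` onto itself — for every log-shell signature. [cite: DupuyHilado2025, §4.7] -/
theorem permute_image_shellPk (j : T.Label) (vQ : T.VQ) (σ : Equiv.Perm (T.Caps j)) :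
    (L.permute j vQ σ) '' (L.shellPk j vQ : Set (L.Packet j vQ)) = L.shellPk j vQ := by
  apply L.image_shellPk_of_image_shellTensors
  ext t
  constructor
  · rintro ⟨_, ⟨x, hx, rfl⟩, rfl⟩
    exact ⟨fun i => x (σ.symm i), fun i v => hx (σ.symm i) v, L.permute_tprod j vQ σ x⟩
  · rintro ⟨x, hx, rfl⟩
    refine ⟨L.tprod j vQ (fun i => x (σ i)), ⟨fun i => x (σ i), fun i v => hx (σ i) v, rfl⟩, ?_⟩
    rw [L.permute_tprod j vQ σ]
    congr 1
    funext i
    rw [Equiv.apply_symm_apply]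

/-- A summand automorphism mapping the log-shell onto itself maps the subgroup it generates onto itself.
[folklore] -/
theorem image_shellSubgroup_of_image_shell {v : T.V} (g : L.carrier v ≃ₗ[ℚ] L.carrier v)
    (hg : g '' L.shell v = L.shell v) :
    g '' (L.shellSubgroup v : Set (L.carrier v)) = L.shellSubgroup v := by
  set g' := g.toLinearMap.toAddMonoidHom
  have hgg : (⇑g' : L.carrier v → L.carrier v) = ⇑g := rfl
  have h := AddMonoidHom.map_closure g' (L.shell v)
  have h2 : g' '' (AddSubgroup.closure (L.shell v) : Set (L.carrier v)) =
      (AddSubgroup.closure (g' '' L.shell v) : Set (L.carrier v)) := by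
    rw [← AddSubgroup.coe_map, h]
  unfold shellSubgroup
  rw [← hgg, h2, hgg, hg]

/-- Membership form of the previous lemma. [folklore] -/
theorem mem_shellSubgroup_of_image_shell {v : T.V} (g : L.carrier v ≃ₗ[ℚ] L.carrier v)
    (hg : g '' L.shell v = L.shell v) {a : L.carrier v} (ha : a ∈ L.shellSubgroup v) :
    g a ∈ L.shellSubgroup v := by
  have : g a ∈ g '' (L.shellSubgroup v : Set (L.carrier v)) := ⟨a, ha, rfl⟩
  rwa [L.image_shellSubgroup_of_image_shell g hg] at this

/-- The inverse of a shell-preserving automorphism preserves the shell. [folklore] -/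
theorem symm_image_shell_of_image_shell {v : T.V} (g : L.carrier v ≃ₗ[ℚ] L.carrier v)
    (hg : g '' L.shell v = L.shell v) : g.symm '' L.shell v = L.shell v := by
  conv_lhs => rw [← hg]
  rw [← Set.image_comp]
  convert Set.image_id _
  funext a
  exact g.symm_apply_apply a

/-- **(Ind2)-type families PRESERVE THE LATTICE** (Dupuy–Hilado §4 p. 13: "the Ind2 indeterminacies also preserve
this lattice"): an automorphism of the packet acting by `g_{i,v}` on the summand `v` of the factor `i`, each
`g_{i,v}` mapping the log-shell `I_v` onto itself, maps `I(^{S^±_{j+1}};D⊢_{v_ℚ})` onto itself — for every log-shell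
signature. [cite: DupuyHilado2025, §4.9] -/
theorem factorwise_summandwise_image_shellPk (j : T.Label) (vQ : T.VQ)
    (g : T.Caps j → ∀ v : T.Fibre vQ, L.carrier v.1 ≃ₗ[ℚ] L.carrier v.1)
    (hg : ∀ i (v : T.Fibre vQ), g i v '' L.shell v.1 = L.shell v.1) :
    (L.factorwise j vQ fun i => L.summandwise vQ (g i)) '' (L.shellPk j vQ : Set (L.Packet j vQ)) =
      L.shellPk j vQ := by
  apply L.image_shellPk_of_image_shellTensors
  ext t
  constructor
  · rintro ⟨_, ⟨x, hx, rfl⟩, rfl⟩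
    refine ⟨fun i v => g i v (x i v), fun i v => L.mem_shellSubgroup_of_image_shell (g i v) (hg i v) (hx i v), ?_⟩
    exact L.factorwise_summandwise_tprod j vQ g x
  · rintro ⟨x, hx, rfl⟩
    refine ⟨L.tprod j vQ (fun i v => (g i v).symm (x i v)), ⟨fun i v => (g i v).symm (x i v), fun i v =>
      L.mem_shellSubgroup_of_image_shell (g i v).symm (L.symm_image_shell_of_image_shell (g i v) (hg i v))
        (hx i v), rfl⟩, ?_⟩
    rw [L.factorwise_summandwise_tprod j vQ g]
    congr 1
    funext i v
    exact (g i v).apply_symm_apply (x i v)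

/-- **(Ind1) preserves the integral structures** whenever every strip automorphism of the signature preserves
the log-shells: an element of c312-1's `Ind1 j` (one permutation + strip automorphisms per factor and summand)
maps `I(^{S^±_{j+1}};D⊢_{v_ℚ})` onto itself at every `v_ℚ`. [cite: DupuyHilado2025, §4.7] -/
theorem image_shellPk_of_mem_Ind1 (hstrip : ∀ v, ∀ h ∈ L.stripAut v, h '' L.shell v = L.shell v) {j : T.Label}
    {Φ : ∀ vQ : T.VQ, L.Packet j vQ ≃ₗ[ℚ] L.Packet j vQ} (hΦ : Φ ∈ L.Ind1 j) (vQ : T.VQ) :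
    Φ vQ '' (L.shellPk j vQ : Set (L.Packet j vQ)) = L.shellPk j vQ := by
  obtain ⟨σ, h, hh, hΦ⟩ := hΦ
  have hcomp : (⇑(Φ vQ) : L.Packet j vQ → L.Packet j vQ) =
      ⇑(L.factorwise j vQ fun i => L.summandwise vQ fun v : T.Fibre vQ => h i v.1) ∘ ⇑(L.permute j vQ σ) := by
    rw [hΦ vQ]; rfl
  rw [hcomp, Set.image_comp, L.permute_image_shellPk j vQ σ]
  exact L.factorwise_summandwise_image_shellPk j vQ (fun i v => h i v.1) fun i v => hstrip v.1 _ (hh i v.1)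

/-- **(Ind2) preserves the integral structures** whenever every element of `Ism` of the signature preserves the
log-shells: an element of c312-1's `Ind2 j v_ℚ` maps `I(^{S^±_{j+1}};D⊢_{v_ℚ})` onto itself.
[cite: DupuyHilado2025, §4.9] -/
theorem image_shellPk_of_mem_Ind2 {j : T.Label} {vQ : T.VQ}
    (hism : ∀ v : T.Fibre vQ, ∀ g ∈ L.ism v.1, g '' L.shell v.1 = L.shell v.1)
    {φ : L.Packet j vQ ≃ₗ[ℚ] L.Packet j vQ} (hφ : φ ∈ L.Ind2 j vQ) :
    φ '' (L.shellPk j vQ : Set (L.Packet j vQ)) = L.shellPk j vQ := by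
  obtain ⟨g, hg, rfl⟩ := hφ
  exact L.factorwise_summandwise_image_shellPk j vQ g fun i v => hism v _ (hg i v)

end LogShells

/-! ## The Dupuy–Hilado-level instance: unconditional at every prime -/

namespace Real

variable {F : Type} [Field F] [NumberField F] (X : PilotData F) (logv : PadicLogs F)

/-- For the DH instance every strip automorphism (there is only the identity) preserves the shells. [folklore] -/
theorem stripAutDH_image_shell (x : Place F) (h : Carrier x ≃ₗ[ℚ] Carrier x) (hh : h ∈ stripAutDH x) :
    h '' shell logv x = shell logv x := by
  have : h = LinearEquiv.refl ℚ (Carrier x) := hh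
  subst this
  exact Set.image_id' _

/-- For the DH instance, at a FINITE place every element of `Ism` maps the log-shell onto itself (by definition of
`ismDH`). [cite: DupuyHilado2025, §4.9] -/
theorem ismDH_image_shell_inr (v : HeightOneSpectrum (𝓞 F)) (g : Carrier (.inr v : Place F) ≃ₗ[ℚ] _)
    (hg : g ∈ ismDH logv (.inr v)) : g '' shell logv (.inr v) = shell logv (.inr v) := hg.2.2

/-- **(Ind1) of the Dupuy–Hilado-level instance fixes the lattices** `I(^{S^±_{j+1}};D⊢_{v_ℚ})` at every `v_ℚ`
(DH §4.7 p. 14, kernel-checked for c312-1's `Ind1` on the defined integral structures).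
[cite: DupuyHilado2025, §4.7] -/
theorem ind1_image_shellPk_DH {j : (thetaIndex X).Label}
    {Φ : ∀ vQ : RatPlace, (logShellsDH X logv).Packet j vQ ≃ₗ[ℚ] (logShellsDH X logv).Packet j vQ}
    (hΦ : Φ ∈ (logShellsDH X logv).Ind1 j) (vQ : RatPlace) :
    Φ vQ '' ((logShellsDH X logv).shellPk j vQ : Set _) = (logShellsDH X logv).shellPk j vQ :=
  (logShellsDH X logv).image_shellPk_of_mem_Ind1 (fun x h hh => stripAutDH_image_shell logv x h hh) hΦ vQ

/-- **(Ind2) of the Dupuy–Hilado-level instance preserves the lattices** `I(^{S^±_{j+1}};D⊢_{v_ℚ})` at every PRIME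
`p` (DH §4 p. 13, kernel-checked for c312-1's `Ind2` on the defined integral structures; no `LogvLaw` needed —
set preservation, not volume preservation). [cite: DupuyHilado2025, §4.9] -/
theorem ind2_image_shellPk_DH {j : (thetaIndex X).Label} (p : Nat.Primes)
    {φ : (logShellsDH X logv).Packet j (.inr p) ≃ₗ[ℚ] (logShellsDH X logv).Packet j (.inr p)}
    (hφ : φ ∈ (logShellsDH X logv).Ind2 j (.inr p)) :
    φ '' ((logShellsDH X logv).shellPk j (.inr p) : Set _) = (logShellsDH X logv).shellPk j (.inr p) := by
  refine (logShellsDH X logv).image_shellPk_of_mem_Ind2 (fun v g hg => ?_) hφ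
  obtain ⟨x, hx⟩ := v
  rcases x with w | w
  · exact absurd hx (by simp [thetaIndex])
  · exact ismDH_image_shell_inr logv w g hg

end Real

/-! ## The SECOND integral structure `I(^{S^±_{j+1},j};D⊢_v)` under (Ind2) (appended; theorems only) -/

namespace LogShells

variable (L : LogShells T)

/-- The generating set of `I(^{S^±_{j+1},j};D⊢_v)`: pure tensors of shell elements whose `j`-th component is
supported on the summand `v` — `L.shellSub j v` is its additive closure by definition. [folklore] -/
theorem shellSub_eq_closure (j : T.Label) (v : T.V) :
    L.shellSub j v = AddSubgroup.closure
      {t | ∃ x : T.Caps j → L.Packet1 (T.over v), (∀ i (w : T.Fibre (T.over v)), x i w ∈ L.shellSubgroup w.1) ∧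
        (∀ w : T.Fibre (T.over v), w.1 ≠ v → x (T.selfIndex j) w = 0) ∧ t = L.tprod j _ x} := rfl

/-- A linear automorphism mapping a generating set onto itself maps its additive closure onto itself.
[folklore] -/
theorem image_closure_of_image_eq {M : Type} [AddCommGroup M] [Module ℚ M] (f : M ≃ₗ[ℚ] M) (S : Set M)
    (hf : f '' S = S) : f '' (AddSubgroup.closure S : Set M) = AddSubgroup.closure S := by
  set f' := f.toLinearMap.toAddMonoidHom
  have hff : (⇑f' : M → M) = ⇑f := rfl
  have h := AddMonoidHom.map_closure f' S
  have h2 : f' '' (AddSubgroup.closure S : Set M) = (AddSubgroup.closure (f' '' S) : Set M) := by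
    rw [← AddSubgroup.coe_map, h]
  rw [← hff, h2, hff, hf]

/-- **(Ind2)-type families PRESERVE THE SECOND INTEGRAL STRUCTURE** `I(^{S^±_{j+1},j};D⊢_v)` ([IUTchIII] Prop. 3.2
(ii) "`I(^{A,α}D⊢_v) ⊆ log(^{A,α}D⊢_v)`"): a summand-wise family `g_{i,w}`, each mapping `I_w` onto itself, maps the
pure tensors of shell elements supported at `v` in the factor `j` onto themselves (`g_{j,w}(0) = 0` keeps the
support condition) — for every log-shell signature. [cite: DupuyHilado2025, §4.9] -/
theorem factorwise_summandwise_image_shellSub (j : T.Label) (v : T.V)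
    (g : T.Caps j → ∀ w : T.Fibre (T.over v), L.carrier w.1 ≃ₗ[ℚ] L.carrier w.1)
    (hg : ∀ i (w : T.Fibre (T.over v)), g i w '' L.shell w.1 = L.shell w.1) :
    (L.factorwise j (T.over v) fun i => L.summandwise (T.over v) (g i)) ''
        (L.shellSub j v : Set (L.Packet j (T.over v))) = L.shellSub j v := by
  rw [shellSub_eq_closure]
  apply image_closure_of_image_eq
  ext t
  constructor
  · rintro ⟨_, ⟨x, hx, hx0, rfl⟩, rfl⟩
    refine ⟨fun i w => g i w (x i w), fun i w => L.mem_shellSubgroup_of_image_shell (g i w) (hg i w) (hx i w),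
      fun w hw => ?_, L.factorwise_summandwise_tprod j _ g x⟩
    simp only [hx0 w hw, map_zero]
  · rintro ⟨x, hx, hx0, rfl⟩
    refine ⟨L.tprod j _ (fun i w => (g i w).symm (x i w)), ⟨fun i w => (g i w).symm (x i w), fun i w =>
      L.mem_shellSubgroup_of_image_shell (g i w).symm (L.symm_image_shell_of_image_shell (g i w) (hg i w))
        (hx i w), fun w hw => ?_, rfl⟩, ?_⟩
    · simp only [hx0 w hw, map_zero]
    · rw [L.factorwise_summandwise_tprod j _ g]
      congr 1
      funext i w
      exact (g i w).apply_symm_apply (x i w)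

/-- **(Ind2) preserves the second integral structures** whenever every element of `Ism` preserves the shells.
[cite: DupuyHilado2025, §4.9] -/
theorem image_shellSub_of_mem_Ind2 {j : T.Label} {v : T.V}
    (hism : ∀ w : T.Fibre (T.over v), ∀ g ∈ L.ism w.1, g '' L.shell w.1 = L.shell w.1)
    {φ : L.Packet j (T.over v) ≃ₗ[ℚ] L.Packet j (T.over v)} (hφ : φ ∈ L.Ind2 j (T.over v)) :
    φ '' (L.shellSub j v : Set (L.Packet j (T.over v))) = L.shellSub j v := by
  obtain ⟨g, hg, rfl⟩ := hφ
  exact L.factorwise_summandwise_image_shellSub j v g fun i w => hism w _ (hg i w)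

end LogShells

namespace Real

variable {F : Type} [Field F] [NumberField F] (X : PilotData F) (logv : PadicLogs F)

/-- **(Ind2) of the Dupuy–Hilado-level instance preserves the second integral structures**
`I(^{S^±_{j+1},j};D⊢_v)` at every FINITE `v` (unconditionally: set preservation). [cite: DupuyHilado2025, §4.9] -/
theorem ind2_image_shellSub_DH {j : (thetaIndex X).Label} (w : HeightOneSpectrum (𝓞 F))
    {φ : (logShellsDH X logv).Packet j ((thetaIndex X).over (.inr w)) ≃ₗ[ℚ]
      (logShellsDH X logv).Packet j ((thetaIndex X).over (.inr w))}
    (hφ : φ ∈ (logShellsDH X logv).Ind2 j ((thetaIndex X).over (.inr w))) :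
    φ '' ((logShellsDH X logv).shellSub j (.inr w) : Set _) = (logShellsDH X logv).shellSub j (.inr w) := by
  refine (logShellsDH X logv).image_shellSub_of_mem_Ind2 (fun u g hg => ?_) hφ
  obtain ⟨x, hx⟩ := u
  rcases x with w' | w'
  · exact absurd hx (by simp [thetaIndex])
  · exact ismDH_image_shell_inr logv w' g hg

end Real

end Summit.ABC.IUTFork.Thm311
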